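import Mathlib.MeasureTheory.Integral.Bochner.Basic
import Mathlib.Logic.Function.DependsOn
import Mathlib.Algebra.Order.Monoid.Units
import Mathlib.Topology.Algebra.InfiniteSum.ENNReal
import Literature.Probability.LatticeModels.ThermodynamicLimit
import Literature.Probability.LatticeModels.IsingModel
import Literature.Probability.LatticeModels.IsingThermodynamics
import Literature.Probability.LatticeModels.GibbsSpecification
import HarnessLib

-- provenance: harness21/H21/H21/Statements/CritIsing/GibbsStates.lean @ 2141302 (interim HEAD d8f2665); M5 mechanical rewrite
/-!
# Critical Ising family (`crit-ising`): Gibbs states, `β_c`, Peierls, DLR structure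

Statement file of trunk G02 (T-STATMECH) for the family `crit-ising`, on the nearest-neighbour
Ising model on `ℤ^d` (`zdGraph d`, boxes `box d L`).

## Covered statement ids

* **crit-ising.S04** (definition role) — the finite-volume Gibbs formula
  `μ_{Λ;β,h}^{bc}({σ}) = e^{-β H(σ)} / Z`, attached to the contentful characterisation
  `isingMeasure_singleton_eq` of the prelude definition `isingMeasure` (built with
  `Measure.tilted`).
* **crit-ising.S05** — existence of the infinite-volume states `⟨·⟩⁺`, `⟨·⟩^∅` along boxes
  (GKS/FKG monotone limits, `hasBoxLimit_isingCorr_plus_free`); the plus state `μ⁺`, the free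
  state `μ^∅` (and, for the sandwich and S25, the minus state `μ⁻`) are translation-invariant
  DLR Gibbs measures (`exists_plusMeasure`, `exists_freeMeasure`, `exists_minusMeasure`); and
  the FKG sandwich `μ⁻ ≤ μ ≤ μ⁺` for every Gibbs measure (`fkg_sandwich`) (Friedli–Velenik
  2017, Thm. 3.17, Exercise 3.16, Thm. 6.26, Lemma 6.30 / Prop. 6.31; Griffiths 1967;
  Fortuin–Kasteleyn–Ginibre 1971).
* **crit-ising.S06** (definition role) — `m*(β)`, `χ(β)`, `β_c(d)`, `ξ(β)`: attached to the
  contentful characterisations `spontaneousMagnetization_eq_zero_of_lt_criticalBeta`,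
  `spontaneousMagnetization_pos_of_criticalBeta_lt` and `susceptibility_eq_one_add_tsum`
  (`χ = 1 + ∑_{x ≠ 0} ⟨σ₀σ_x⟩^∅`).
* **crit-ising.S07** — Peierls / Griffiths phase transition: `0 < β_c(d)` (`criticalBeta_pos`)
  and `β_c(d) < ∞` (`exists_spontaneousMagnetization_pos`) for `d ≥ 2`, high-temperature
  `m* = 0`, and the Peierls contour bound `m*(β) ≥ 1 - C e^{-cβ}`
  (Peierls 1936; Griffiths 1964; Dobrushin 1965; Friedli–Velenik 2017, Thm. 3.25).
* **crit-ising.S25** — DLR structure of `𝒢(β)`. The inventory's first clause ("the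
  infinite-volume Gibbs measures are exactly the DLR measures for the Ising specification") is
  definitional in this library: `isingGibbsMeasures d β h := gibbsMeasures (isingSpecification
  (zdGraph d) β h)` with `mem_isingGibbsMeasures_iff` (prelude `GibbsSpecification`). Stated
  here: uniqueness for `β < β_c` (Lebowitz–Martin-Löf 1972), Aizenman–Higuchi on `ℤ²`,
  Dobrushin non-translation-invariant states on `ℤ³`, Bodineau's theorem on translation
  invariant states for `d ≥ 3` (Georgii 2011, Ch. 6 and §18; Aizenman 1980; Higuchi 1981;
  Dobrushin 1972; Bodineau 2006). The parenthetical clause of S25 (uniqueness at `β = β_c` for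
  `d ≥ 3`, Aizenman–Duminil-Copin–Sidoravicius 2015) is `hasUniqueGibbsMeasure_criticalBeta`
  in `H21/Statements/CritIsing/Sharpness.lean`.

## Design choices

* All objects (`isingMeasure`, `plusExpect`, `plusCorr`, `spontaneousMagnetization`,
  `criticalBeta`, `susceptibility`, `isingSpecification`, `IsGibbsMeasure`,
  `isingGibbsMeasures`, `IsTranslationInvariantMeasure`, `HasBoxLimit`, …) come from the
  accepted `Literature.Prelude.StatMech` files; this file only states theorems about them.
* "`β_c(d) < ∞`" is rendered as non-emptiness of the defining set of `criticalBeta d`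
  (`∃ β, 0 ≤ β ∧ 0 < m*(β)`), which is exactly what makes `sInf` non-junk.
* Increasing observables for FKG are Mathlib `Monotone` functions for the Pi order on
  `SpinConfig (Site d) = Site d → ℤˣ` induced by Mathlib's `LinearOrder ℤˣ`
  (`Mathlib/Algebra/Order/Monoid/Units.lean`); locality is Mathlib `DependsOn`.
* Mixtures of `μ⁺` and `μ⁻` are written with the `ℝ≥0∞`-module structure of `Measure`,
  `μ = t • μ⁺ + (1 - t) • μ⁻` with `t ≤ 1` (outline §3, fixed shape).
* Bodineau's theorem is stated for all `d ≥ 3` (its published generality), specialising the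
  outline's `d = 3`.
* `plusCorr`/`minusCorr`/`freeCorr` are `limUnder`s along boxes; the prelude proves they are
  genuine limits for `β ≥ 0`, `h ≥ 0`, and they are genuine limits for every `h ∈ ℝ` by
  Friedli–Velenik 2017, Thm. 3.17 / Exercise 3.16, so `exists_plusMeasure` and
  `exists_minusMeasure` are stated for all `h`, `exists_freeMeasure` for `h ≥ 0` (matching the
  prelude lemma `hasBoxLimit_isingCorr_free`).
* Gibbs measures are always written `μ ∈ isingGibbsMeasures d β h`
  (`= gibbsMeasures (isingSpecification (zdGraph d) β h)`, see `mem_isingGibbsMeasures_iff`).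
* A few statements are actually proved from prelude API (`isingMeasure_singleton_eq`,
  `hasBoxLimit_isingCorr_plus_free`, `spontaneousMagnetization_eq_zero_of_lt_criticalBeta`,
  `spontaneousMagnetization_pos_of_criticalBeta_lt`, `exists_spontaneousMagnetization_pos`
  (from `peierls_bound`), `susceptibility_eq_one_add_tsum`); the remaining known theorems are
  `sorry` with citations.

## Mathlib status

Mathlib has no Ising model, Gibbs measures, spontaneous magnetisation or Peierls argument
(searched: `Ising`, `Gibbs`, `Peierls`, `magnetization`, `partitionFunction`). Anchors used:
`Measure.tilted` (via the prelude), `Monotone`, `DependsOn`, `tsum`, `ENNReal.ofReal`,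
`ENNReal.sum_add_tsum_compl`, `tsum_congr_subtype`, `csInf_le`, `exists_lt_of_csInf_lt`.

## References

* R. Peierls, *On Ising's model of ferromagnetism*, Proc. Camb. Phil. Soc. 32 (1936) 477–481.
* R. B. Griffiths, *Peierls proof of spontaneous magnetization in a two-dimensional Ising
  ferromagnet*, Phys. Rev. 136 (1964) A437–A439.
* R. L. Dobrushin, Theory Probab. Appl. 10 (1965) 193; 17 (1972) 582–600 (non-translation
  invariant states).
* R. B. Griffiths, J. Math. Phys. 8 (1967) 478–483 (GKS).
* C. M. Fortuin, P. W. Kasteleyn, J. Ginibre, Comm. Math. Phys. 22 (1971) 89–103 (FKG).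
* M. Aizenman, Comm. Math. Phys. 73 (1980) 83–94; Y. Higuchi, in *Random Fields* (Esztergom
  1979), Colloq. Math. Soc. János Bolyai 27 (1981) 517–534.
* T. Bodineau, *Translation invariant Gibbs states for the Ising model*, Probab. Theory Related
  Fields 135 (2006) 153–168.
* J. L. Lebowitz, A. Martin-Löf, *On the uniqueness of the equilibrium state for Ising spin
  systems*, Comm. Math. Phys. 25 (1972) 276–282 (`|𝒢(β,0)| = 1 ↔ m*(β) = 0`).
* H.-O. Georgii, *Gibbs Measures and Phase Transitions*, 2nd ed. (de Gruyter 2011), Ch. 6, §18.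
* S. Friedli, Y. Velenik, *Statistical Mechanics of Lattice Systems* (CUP 2017), Ch. 3 and Ch. 6.
-/

noncomputable section

open MeasureTheory Filter Topology Finset Literature.Probability.LatticeModels
open scoped ENNReal

namespace Literature.Probability.LatticeModels

variable {d : ℕ} {β h : ℝ}

/-! ### crit-ising.S04 — the finite-volume Gibbs formula -/

/-- **crit-ising.S04** (finite-volume Ising model with boundary condition; summits/crit-ising3d
Definitions; Friedli–Velenik 2017, §3.1, Def. 3.1 and eq. (3.7)).
For a finite `Λ ⊂ ℤ^d`, a boundary condition `bc ∈ {−1,+1}^{ℤ^d∖Λ} ∪ {free}` and a finite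
configuration `τ ∈ {−1,+1}^Λ`, the Gibbs probability of the glued configuration is
`μ_{Λ;β,h}^{bc}({τ·bc}) = exp(-β H_{Λ;h}^{bc}(τ·bc)) / Z_{Λ;β,h}^{bc}`, where
`-H = ∑_{xy ⊂ Λ} σ_x σ_y (+ ∑_{x ∈ Λ, y ∉ Λ, x ∼ y} σ_x ω_y for bc = ω) + h ∑_{x ∈ Λ} σ_x` and
`Z = ∑_τ exp(-β H)`. [cite: FriedliVelenik2017, §3.1  Def. 3.1 and eq. (3.7] -/
def isingMeasure_singleton_eq : Prop :=
  ∀ (β h : ℝ) (Λ : Finset (Site d)) (τ : Λ → ℤˣ) (bc : BoundaryCondition (Site d)),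
    isingMeasure (zdGraph d) Λ β h bc {glue Λ τ bc} =
      ENNReal.ofReal (isingWeight (zdGraph d) Λ β h bc τ /
        isingPartitionFunction (zdGraph d) Λ β h bc)

/- interim proof relied on results that are now named facts (D-0014); demoted to a fact by the M5 import, proof preserved:
:=
  isingMeasure_apply_singleton (zdGraph d) Λ β h bc τ
-/

/-! ### crit-ising.S05 — infinite-volume states and the FKG sandwich -/

/-- **crit-ising.S05** (existence of `⟨σ_A⟩⁺_β` and `⟨σ_A⟩^∅_β`; Friedli–Velenik 2017,
Thm. 3.17 and Exercises 3.15–3.16; Griffiths, J. Math. Phys. 8 (1967); FKG, CMP 22 (1971)).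
For `β ≥ 0`, `h ≥ 0` and every finite `A ⊂ ℤ^d`, the limits
`⟨σ_A⟩⁺_{β,h} = lim_{L → ∞} ⟨σ_A⟩⁺_{B(L);β,h}` and `⟨σ_A⟩^∅_{β,h} = lim_{L → ∞} ⟨σ_A⟩^∅_{B(L);β,h}`
exist (monotone in the volume by FKG resp. GKS). [cite: FriedliVelenik2017, Thm. 3.17 and Exercises 3.15–3.16] -/
def hasBoxLimit_isingCorr_plus_free : Prop :=
  ∀ (hβ : 0 ≤ β) (hh : 0 ≤ h) (A : Finset (Site d)),
    HasBoxLimit (fun Λ => isingCorr (zdGraph d) Λ β h .plus A) (plusCorr d β h A) ∧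
      HasBoxLimit (fun Λ => isingCorr (zdGraph d) Λ β h .free A) (freeCorr d β h A)

/- interim proof relied on results that are now named facts (D-0014); demoted to a fact by the M5 import, proof preserved:
:=
  ⟨hasBoxLimit_isingCorr_plus d hβ hh A, hasBoxLimit_isingCorr_free d hβ hh A⟩
-/

variable (d h) in
/-- **crit-ising.S05** (the plus state is a translation-invariant Gibbs measure;
Friedli–Velenik 2017, Thm. 3.17 (translation invariance), Thm. 6.26 / Lemma 6.7 (`μ⁺ ∈ 𝒢(β,h)`);
Georgii 2011, §6.2).
For `β ≥ 0` and every `h ∈ ℝ` there is a probability measure `μ⁺_{β,h}` on `{−1,+1}^{ℤ^d}`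
which satisfies the DLR equations for the Ising specification, is translation invariant, and
whose correlations are `⟨σ_A⟩⁺_{β,h} = plusCorr d β h A` (the box limits, which exist for every
`h` by F–V Thm. 3.17; the prelude records this for `h ≥ 0`). [cite: FriedliVelenik2017, Thm. 3.17 (translation invariance] -/
def exists_plusMeasure : Prop :=
  ∀ (hβ : 0 ≤ β),
    ∃ μ ∈ isingGibbsMeasures d β h, IsTranslationInvariantMeasure μ ∧
      ∀ A : Finset (Site d), spinCorr μ A = plusCorr d β h A

variable (d h) in
/-- **crit-ising.S05** (the free state is a translation-invariant Gibbs measure;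
Friedli–Velenik 2017, Exercise 3.16 (existence and translation invariance of `⟨·⟩^∅` by GKS)
and Thm. 6.26 (thermodynamic limits of finite-volume Gibbs measures lie in `𝒢`); Georgii 2011,
§6.2).
For `β ≥ 0` and `h ≥ 0` there is a probability measure `μ^∅_{β,h}` on `{−1,+1}^{ℤ^d}` which
satisfies the DLR equations for the Ising specification, is translation invariant, and whose
correlations are the box limits `⟨σ_A⟩^∅_{β,h} = freeCorr d β h A`
(cf. `hasBoxLimit_isingCorr_plus_free`). [cite: FriedliVelenik2017, Exercise 3.16 (existence and translation] -/
def exists_freeMeasure : Prop :=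
  ∀ (hβ : 0 ≤ β) (hh : 0 ≤ h),
    ∃ μ ∈ isingGibbsMeasures d β h, IsTranslationInvariantMeasure μ ∧
      ∀ A : Finset (Site d), spinCorr μ A = freeCorr d β h A

variable (d h) in
/-- **crit-ising.S05** (the minus state is a translation-invariant Gibbs measure;
Friedli–Velenik 2017, Thm. 3.17, Thm. 6.26; Georgii 2011, §6.2).
For `β ≥ 0` and every `h ∈ ℝ` there is a probability measure `μ⁻_{β,h}` on `{−1,+1}^{ℤ^d}`
which satisfies the DLR equations for the Ising specification, is translation invariant, and
whose correlations are `⟨σ_A⟩⁻_{β,h} = minusCorr d β h A` (box limits, existing for every `h`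
by F–V Thm. 3.17 and spin-flip symmetry). Needed for the FKG sandwich and for S25. [cite: FriedliVelenik2017, Thm. 3.17  Thm. 6.26] -/
def exists_minusMeasure : Prop :=
  ∀ (hβ : 0 ≤ β),
    ∃ μ ∈ isingGibbsMeasures d β h, IsTranslationInvariantMeasure μ ∧
      ∀ A : Finset (Site d), spinCorr μ A = minusCorr d β h A

variable (d h) in
/-- **crit-ising.S05** (FKG sandwich; Friedli–Velenik 2017, Lemma 6.30 and Prop. 6.31 /
eq. (6.68); Fortuin–Kasteleyn–Ginibre, CMP 22 (1971)).
For `β ≥ 0`, every infinite-volume Ising Gibbs measure `μ ∈ 𝒢(β,h)` lies between `μ⁻` and `μ⁺`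
in the FKG order: `⟨f⟩⁻_{β,h} ≤ μ(f) ≤ ⟨f⟩⁺_{β,h}` for every bounded local nondecreasing
observable `f` (nondecreasing for the coordinatewise order on `{−1,+1}^{ℤ^d}`; boundedness is
automatic for local `f` and kept only for readability). [cite: FriedliVelenik2017, Lemma 6.30 and Prop. 6.31 / eq. (6.68] -/
def fkg_sandwich : Prop :=
  ∀ (hβ : 0 ≤ β),
    ∀ μ ∈ isingGibbsMeasures d β h, ∀ f : SpinConfig (Site d) → ℝ, Monotone f →
      (∃ Λ : Finset (Site d), DependsOn f (↑Λ : Set (Site d))) → (∃ C, ∀ σ', |f σ'| ≤ C) →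
        minusExpect d β h f ≤ ∫ σ', f σ' ∂μ ∧ ∫ σ', f σ' ∂μ ≤ plusExpect d β h f

/-! ### crit-ising.S07 — Peierls: `0 < β_c(d) < ∞` for `d ≥ 2` -/

variable (d) in
/-- **crit-ising.S07** (high-temperature absence of spontaneous magnetisation; Friedli–Velenik
2017, Thm. 3.25 (i) with §3.7.3; Dobrushin 1965).
There is `β₀ > 0` such that `m*(β) = 0` for all `0 ≤ β < β₀` (in every dimension). [cite: Dobrushin1965] -/
def spontaneousMagnetization_eq_zero_of_small : Prop :=
  ∃ β₀ > 0, ∀ β ∈ Set.Ico 0 β₀, spontaneousMagnetization d β = 0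

/-- **crit-ising.S07** (Peierls' contour bound; Peierls 1936; Griffiths 1964;
Friedli–Velenik 2017, Thm. 3.25 (ii) and eq. (3.51)–(3.53)).
For `d ≥ 2` there are constants `C` and `c > 0` with `m*(β) ≥ 1 - C e^{-c β}` for all `β ≥ 0`;
in particular `m*(β) > 0` for `β` large. [cite: Peierls1936] -/
def peierls_bound : Prop :=
  ∀ (hd : 2 ≤ d),
    ∃ C c : ℝ, 0 < c ∧ ∀ β ≥ 0, 1 - C * Real.exp (-c * β) ≤ spontaneousMagnetization d β

/-- **crit-ising.S07** (`β_c(d) < ∞`: spontaneous magnetisation occurs; Peierls 1936;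
Griffiths, Phys. Rev. 136 (1964) A437; Friedli–Velenik 2017, Thm. 3.25 (ii)).
For `d ≥ 2` there is `β ≥ 0` with `m*(β) > 0`, i.e. the defining set
`{β ≥ 0 | m*(β) > 0}` of `β_c(d) = inf {…}` is nonempty, so the infimum is finite and non-junk.
(A corollary of `peierls_bound`, from which it is derived here.) [cite: Peierls1936] -/
def exists_spontaneousMagnetization_pos : Prop :=
  ∀ (hd : 2 ≤ d),
    ∃ β : ℝ, 0 ≤ β ∧ 0 < spontaneousMagnetization d β

/- interim proof relied on results that are now named facts (D-0014); demoted to a fact by the M5 import, proof preserved: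
:= by
  obtain ⟨C, c, hc, hb⟩ := peierls_bound (d := d) hd
  refine ⟨2 * |C| / c, by positivity, lt_of_lt_of_le ?_ (hb _ (by positivity))⟩
  have hexp : c * (2 * |C| / c) + 1 ≤ Real.exp (c * (2 * |C| / c)) := Real.add_one_le_exp _
  have hc2 : c * (2 * |C| / c) = 2 * |C| := by field_simp
  rw [hc2] at hexp
  have hpos : 0 < Real.exp (2 * |C|) := Real.exp_pos _
  have key : C * Real.exp (-c * (2 * |C| / c)) ≤ |C| / (2 * |C| + 1) := by
    rw [show -c * (2 * |C| / c) = -(2 * |C|) by rw [neg_mul, hc2], Real.exp_neg]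
    calc C * (Real.exp (2 * |C|))⁻¹ ≤ |C| * (Real.exp (2 * |C|))⁻¹ :=
          mul_le_mul_of_nonneg_right (le_abs_self C) (inv_nonneg.2 hpos.le)
      _ = |C| / Real.exp (2 * |C|) := (div_eq_mul_inv _ _).symm
      _ ≤ |C| / (2 * |C| + 1) :=
          div_le_div_of_nonneg_left (abs_nonneg C) (by positivity) hexp
  have hlt : |C| / (2 * |C| + 1) < 1 := by
    rw [div_lt_one (by positivity)]
    linarith [abs_nonneg C]
  linarith
-/

/-- **crit-ising.S07** (`β_c(d) > 0`: no spontaneous magnetisation at high temperature;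
Peierls 1936; Griffiths 1964; Dobrushin 1965; Friedli–Velenik 2017, Thm. 3.25 (i)).
For `d ≥ 2` the critical inverse temperature is strictly positive. (Derived here from
`spontaneousMagnetization_eq_zero_of_small` and `exists_spontaneousMagnetization_pos`; the
hypothesis `2 ≤ d` excludes the junk value `sInf ∅ = 0` in `d ≤ 1`.) [cite: Peierls1936] -/
def criticalBeta_pos : Prop :=
  ∀ (hd : 2 ≤ d),
    0 < criticalBeta d

/- interim proof relied on results that are now named facts (D-0014); demoted to a fact by the M5 import, proof preserved:
:= by
  obtain ⟨β₀, hβ₀, hzero⟩ := spontaneousMagnetization_eq_zero_of_small d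
  refine hβ₀.trans_le (le_csInf (exists_spontaneousMagnetization_pos hd) fun β hβ => ?_)
  by_contra hlt
  exact hβ.2.ne' (hzero β ⟨hβ.1, not_le.1 hlt⟩)
-/

/-! ### crit-ising.S06 — `m*`, `χ`, `β_c`, `ξ` -/

/-- **crit-ising.S06** (`β_c(d) = inf {β : m*(β) > 0}` characterised from below;
summits/crit-ising3d Definitions; Duminil-Copin, arXiv:2208.00864, §1; Friedli–Velenik 2017,
Def. 3.29 with Exercise 3.29 (monotonicity of `m*`, GKS)).
Below the critical inverse temperature there is no spontaneous magnetisation: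
`m*(β) = 0` for `0 ≤ β < β_c(d)`. (Proved from `m* ≥ 0` and the definition of `β_c` as an
infimum.) [cite: FriedliVelenik2017, Def. 3.29 with Exercise 3.29 (monotonici] -/
def spontaneousMagnetization_eq_zero_of_lt_criticalBeta : Prop :=
  ∀ (hβ : 0 ≤ β) (hlt : β < criticalBeta d),
    spontaneousMagnetization d β = 0

/- interim proof relied on results that are now named facts (D-0014); demoted to a fact by the M5 import, proof preserved:
:= by
  refine le_antisymm (not_lt.1 fun hpos => not_le.2 hlt ?_) (spontaneousMagnetization_nonneg d hβ)
  exact csInf_le ⟨0, fun _ hb => hb.1⟩ ⟨hβ, hpos⟩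
-/

/-- **crit-ising.S06** (`β_c(d) = inf {β : m*(β) > 0}` characterised from above;
summits/crit-ising3d Definitions; Duminil-Copin, arXiv:2208.00864, §1; Friedli–Velenik 2017,
Def. 3.29, Thm. 3.25 and Exercise 3.29).
For `d ≥ 2`, above the critical inverse temperature there is spontaneous magnetisation:
`m*(β) > 0` for `β > β_c(d)`. (Proved from `exists_spontaneousMagnetization_pos` and the
monotonicity of `m*`.) [cite: FriedliVelenik2017, Def. 3.29  Thm. 3.25 and Exercise 3.29] -/
def spontaneousMagnetization_pos_of_criticalBeta_lt : Prop :=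
  ∀ (hd : 2 ≤ d) (hlt : criticalBeta d < β),
    0 < spontaneousMagnetization d β

/- interim proof relied on results that are now named facts (D-0014); demoted to a fact by the M5 import, proof preserved:
:= by
  obtain ⟨β', ⟨hβ'0, hpos⟩, hβ'⟩ :=
    exists_lt_of_csInf_lt (exists_spontaneousMagnetization_pos hd) hlt
  exact hpos.trans_le
    (spontaneousMagnetization_mono d hβ'0 (Set.mem_Ici.2 (hβ'0.trans hβ'.le)) hβ'.le)
-/

variable (d β) in
/-- `⟨σ₀ σ₀⟩^∅_{β,0} = 1`: the free two-point function on the diagonal is `1` since `σ₀² = 1`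
(Friedli–Velenik 2017, §3.7.4). [cite: FriedliVelenik2017, §3.7.4] -/
theorem twoPointFree_zero : twoPointFree d β 0 = 1 := by
  change limUnder atTop (fun L : ℕ => isingTwoPoint (zdGraph d) (box d L) β 0 .free 0 0) = 1
  simp only [isingTwoPoint_self]
  exact tendsto_const_nhds.limUnder_eq

variable (d β) in
/-- **crit-ising.S06** (susceptibility `χ(β) = ∑_x ⟨σ₀ σ_x⟩^∅_β`; summits/crit-ising3d
Definitions; Duminil-Copin, arXiv:2208.00864, §1; Friedli–Velenik 2017, §3.7.4, eq. (3.67)).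
The susceptibility splits off the diagonal term `⟨σ₀²⟩ = 1`:
`χ(β) = 1 + ∑_{x ≠ 0} ⟨σ₀ σ_x⟩^∅_{β,0}` (in `[0, ∞]`). [cite: FriedliVelenik2017, §3.7.4  eq. (3.67] -/
theorem susceptibility_eq_one_add_tsum :
    susceptibility d β = 1 + ∑' x : {x : Site d // x ≠ 0}, ENNReal.ofReal (twoPointFree d β x) := by
  rw [susceptibility, ← ENNReal.sum_add_tsum_compl {0}, Finset.sum_singleton, twoPointFree_zero,
    ENNReal.ofReal_one]
  congr 1
  exact tsum_congr_subtype (fun x => ENNReal.ofReal (twoPointFree d β x)) fun x => by simp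

/-! ### crit-ising.S25 — DLR structure of the set of Gibbs measures -/

/-- **crit-ising.S25** (uniqueness below `β_c`; Lebowitz–Martin-Löf, CMP 25 (1972) 276
(`|𝒢(β,0)| = 1 ↔ m*(β) = 0`); Georgii 2011, Ch. 6 and §18.3; Friedli–Velenik 2017, Thm. 3.28
with Thm. 6.26).
For `d ≥ 2` and `0 ≤ β < β_c(d)` the Ising specification on `ℤ^d` at zero field admits exactly
one Gibbs measure. [cite: Georgii2011, Ch. 6 and §18.3] -/
def hasUniqueGibbsMeasure_of_lt_criticalBeta : Prop :=
  ∀ (hd : 2 ≤ d) (hβ : 0 ≤ β) (hlt : β < criticalBeta d),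
    HasUniqueGibbsMeasure (isingSpecification (zdGraph d) β 0)

/-- **crit-ising.S25** (Aizenman–Higuchi theorem; Aizenman, CMP 73 (1980) 83; Higuchi, Colloq.
Math. Soc. János Bolyai 27 (1981) 517; Georgii 2011, §18; Friedli–Velenik 2017, §3.10.8).
On `ℤ²`, for `β > β_c(2)` every infinite-volume Gibbs measure at zero field is a mixture
`μ = t μ⁺ + (1 - t) μ⁻`, `t ∈ [0, 1]`, of the plus and minus states (the Gibbs measures whose
correlations are `⟨σ_A⟩^±_β`). [cite: Georgii2011, §18] -/
def aizenman_higuchi : Prop :=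
  ∀ (hβ : criticalBeta 2 < β) (μ : Measure (SpinConfig (Site 2))) (hμ : μ ∈ isingGibbsMeasures 2 β 0),
    ∃ μp μm : Measure (SpinConfig (Site 2)),
      μp ∈ isingGibbsMeasures 2 β 0 ∧ μm ∈ isingGibbsMeasures 2 β 0 ∧
        (∀ A, spinCorr μp A = plusCorr 2 β 0 A) ∧ (∀ A, spinCorr μm A = minusCorr 2 β 0 A) ∧
          ∃ t : ℝ≥0∞, t ≤ 1 ∧ μ = t • μp + (1 - t) • μm

/-- **crit-ising.S25** (Dobrushin states; Dobrushin, Theory Probab. Appl. 17 (1972) 582–600;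
van Beijeren, CMP 40 (1975) 1; Georgii 2011, §18 Notes; Friedli–Velenik 2017, §3.10.7).
On `ℤ³`, for all sufficiently large `β` there exists an infinite-volume Ising Gibbs measure at
zero field which is not translation invariant (a rigid interface state). [cite: Georgii2011, §18 Notes] -/
def exists_nonTranslationInvariant_gibbs_dim3 : Prop :=
  ∃ β₀ : ℝ, ∀ β > β₀, ∃ μ ∈ isingGibbsMeasures 3 β 0, ¬ IsTranslationInvariantMeasure μ

/-- **crit-ising.S25** (Bodineau's theorem; Bodineau, *Translation invariant Gibbs states for
the Ising model*, PTRF 135 (2006) 153–168; Georgii 2011, §18 Notes).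
For `d ≥ 3` and `β > β_c(d)`, every *translation-invariant* infinite-volume Ising Gibbs measure
at zero field is a mixture `t μ⁺ + (1 - t) μ⁻`, `t ∈ [0, 1]`, of the plus and minus states.
(Stated for all `d ≥ 3`, Bodineau's generality; the outline's instance is `d = 3`.) [cite: Georgii2011, §18 Notes] -/
def bodineau_translationInvariant : Prop :=
  ∀ (hd : 3 ≤ d) (hβ : criticalBeta d < β),
    ∀ μ ∈ isingGibbsMeasures d β 0, IsTranslationInvariantMeasure μ →
      ∃ μp μm : Measure (SpinConfig (Site d)),
        μp ∈ isingGibbsMeasures d β 0 ∧ μm ∈ isingGibbsMeasures d β 0 ∧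
          (∀ A, spinCorr μp A = plusCorr d β 0 A) ∧ (∀ A, spinCorr μm A = minusCorr d β 0 A) ∧
            ∃ t : ℝ≥0∞, t ≤ 1 ∧ μ = t • μp + (1 - t) • μm

end Literature.Probability.LatticeModels
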